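import Mathlib.LinearAlgebra.Matrix.Kronecker
import Mathlib.Data.Sum.Order
import Mathlib.Data.Finset.Sum
import Literature.MathematicalPhysics.QuantumLattice.FermionOperatorsProofs
import HarnessLib

/-!
# Jordan–Wigner matrices of an ordered sum `ι₁ ⊕ₗ ι₂` as Kronecker products

Support file for the proof of Lieb's flux-phase theorem `Lieb1994_fluxPi_torus`
(`LiebFluxPhase.lean`; E. H. Lieb, PRL **73** (1994) 2158). Lieb splits the lattice by a cutting
plane into a left and a right half, `H = H_L + H_R + H_int` [Lieb1994, eq. (5)], and uses that
even left operators commute with all right operators while the odd cross terms `c†_l c_r`,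
`c_l c†_r` need a sign bookkeeping ("each such move gives rise to a `-1` factor", p. 3). In the
tree's concrete Jordan–Wigner model (`HubbardWave0`: `Fock ι = ℓ²(𝒫 ι)`, `annihilation i`,
`jwSign i s = (-1)^{#{j ∈ s : j < i}}`) this bookkeeping becomes the following EXACT tensor
factorisation, when all left orbitals precede all right orbitals, i.e. for the ordered sum
`ι = ι₁ ⊕ₗ ι₂` (Mathlib's `Sum.Lex` linear order): along the splitting of configurations
`𝒫(ι₁ ⊕ ι₂) ≃ 𝒫 ι₁ × 𝒫 ι₂` (`splitEquiv`, Mathlib's `Finset.sumEquiv`),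

* `c_{inl i} = c_i ⊗ 1`                    (`reindex_annihilation_inl`),
* `c_{inr j} = (-1)^{N₁} ⊗ c_j`              (`reindex_annihilation_inr`, `(-1)^{N₁} = parityOp`),

hence `c†_{inl i} c_{inl i'} = (c†_i c_{i'}) ⊗ 1`, `c†_{inr j} c_{inr j'} = 1 ⊗ (c†_j c_{j'})`, and
for the CROSS hopping terms `c†_{inl i} c_{inr j} = (c†_i P) ⊗ c_j`, `c†_{inr j} c_{inl i} = (P c_i) ⊗ c†_j`
(`P = parityOp`) — the matrix form of Lieb's observation that the interaction through the plane is
a sum of terms `A_L Θ(A_L)` once `Θ(c_l) = c†_r` absorbs the fermionic signs (p. 3). This is the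
standard relation between the Jordan–Wigner transformation and the graded tensor product
(Bratteli–Robinson II §5.2.2, Thm. 5.2.5; Tasaki (2020) §9.2).

## References

* [Lieb1994] E. H. Lieb, Phys. Rev. Lett. 73 (1994) 2158, eq. (5) and proof of the Lemma.
* O. Bratteli, D. W. Robinson, *Operator Algebras and Quantum Statistical Mechanics II*, §5.2.2.
* H. Tasaki, *Physics and Mathematics of Quantum Many-Body Systems* (2020), §9.2.
-/

noncomputable section

namespace Literature.MathematicalPhysics.QuantumLattice

open Matrix Finset HubbardWave0
open scoped Kronecker

namespace JWSplit

section Split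

variable {ι₁ ι₂ : Type*}

/-! ### Splitting configurations of `ι₁ ⊕ₗ ι₂` -/

/-- The splitting of a configuration of the ordered sum `ι₁ ⊕ₗ ι₂` into its left and right parts,
`𝒫(ι₁ ⊕ ι₂) ≃ 𝒫 ι₁ × 𝒫 ι₂` (Mathlib's `Finset.sumEquiv` after forgetting the `Lex` synonym).
[folklore] -/
def splitEquiv : Finset (ι₁ ⊕ₗ ι₂) ≃ Finset ι₁ × Finset ι₂ :=
  (Equiv.finsetCongr (ofLex : ι₁ ⊕ₗ ι₂ ≃ ι₁ ⊕ ι₂)).trans Finset.sumEquiv.toEquiv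

/-- The glued configuration `a ⊔ b`. [folklore] -/
theorem splitEquiv_symm_apply (a : Finset ι₁) (b : Finset ι₂) :
    (splitEquiv.symm (a, b) : Finset (ι₁ ⊕ₗ ι₂)) =
      (a.disjSum b).map (toLex : ι₁ ⊕ ι₂ ≃ ι₁ ⊕ₗ ι₂).toEmbedding := by
  rfl

/-- A left orbital belongs to `a ⊔ b` iff it belongs to `a`. [folklore] -/
@[simp] theorem toLex_inl_mem_iff (i : ι₁) (a : Finset ι₁) (b : Finset ι₂) :
    (toLex (Sum.inl i) : ι₁ ⊕ₗ ι₂) ∈ splitEquiv.symm (a, b) ↔ i ∈ a := by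
  rw [splitEquiv_symm_apply, Finset.mem_map_equiv, Equiv.symm_apply_apply, Finset.inl_mem_disjSum]

/-- A right orbital belongs to `a ⊔ b` iff it belongs to `b`. [folklore] -/
@[simp] theorem toLex_inr_mem_iff (j : ι₂) (a : Finset ι₁) (b : Finset ι₂) :
    (toLex (Sum.inr j) : ι₁ ⊕ₗ ι₂) ∈ splitEquiv.symm (a, b) ↔ j ∈ b := by
  rw [splitEquiv_symm_apply, Finset.mem_map_equiv, Equiv.symm_apply_apply, Finset.inr_mem_disjSum]

/-- Membership in a glued configuration, by cases. [folklore] -/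
theorem toLex_mem_iff (x : ι₁ ⊕ ι₂) (a : Finset ι₁) (b : Finset ι₂) :
    (toLex x : ι₁ ⊕ₗ ι₂) ∈ splitEquiv.symm (a, b) ↔ Sum.elim (· ∈ a) (· ∈ b) x := by
  rcases x with i | j
  · exact toLex_inl_mem_iff i a b
  · exact toLex_inr_mem_iff j a b

/-- The size of a glued configuration. [folklore] -/
theorem card_splitEquiv_symm (a : Finset ι₁) (b : Finset ι₂) :
    (splitEquiv.symm (a, b) : Finset (ι₁ ⊕ₗ ι₂)).card = a.card + b.card := by
  rw [splitEquiv_symm_apply, Finset.card_map, Finset.card_disjSum]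

variable [DecidableEq ι₁] [DecidableEq ι₂] [DecidableEq (ι₁ ⊕ₗ ι₂)]

omit [DecidableEq ι₂] in
/-- Adding a left orbital to a glued configuration. [folklore] -/
theorem insert_toLex_inl (i : ι₁) (a : Finset ι₁) (b : Finset ι₂) :
    insert (toLex (Sum.inl i) : ι₁ ⊕ₗ ι₂) (splitEquiv.symm (a, b)) =
      splitEquiv.symm (insert i a, b) := by
  ext y
  obtain ⟨x, rfl⟩ := (toLex : ι₁ ⊕ ι₂ ≃ ι₁ ⊕ₗ ι₂).surjective y
  rw [Finset.mem_insert, toLex_mem_iff, toLex_mem_iff, (toLex : ι₁ ⊕ ι₂ ≃ ι₁ ⊕ₗ ι₂).apply_eq_iff_eq]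
  rcases x with i' | j <;> simp

omit [DecidableEq ι₁] in
/-- Adding a right orbital to a glued configuration. [folklore] -/
theorem insert_toLex_inr (j : ι₂) (a : Finset ι₁) (b : Finset ι₂) :
    insert (toLex (Sum.inr j) : ι₁ ⊕ₗ ι₂) (splitEquiv.symm (a, b)) =
      splitEquiv.symm (a, insert j b) := by
  ext y
  obtain ⟨x, rfl⟩ := (toLex : ι₁ ⊕ ι₂ ≃ ι₁ ⊕ₗ ι₂).surjective y
  rw [Finset.mem_insert, toLex_mem_iff, toLex_mem_iff, (toLex : ι₁ ⊕ ι₂ ≃ ι₁ ⊕ₗ ι₂).apply_eq_iff_eq]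
  rcases x with i | j' <;> simp

omit [DecidableEq ι₁] [DecidableEq ι₂] [DecidableEq (ι₁ ⊕ₗ ι₂)] in
/-- Filtering a glued configuration filters the two parts. [folklore] -/
theorem filter_splitEquiv_symm (p : ι₁ ⊕ₗ ι₂ → Prop) [DecidablePred p] (a : Finset ι₁)
    (b : Finset ι₂) :
    (splitEquiv.symm (a, b) : Finset (ι₁ ⊕ₗ ι₂)).filter p =
      splitEquiv.symm (a.filter fun i => p (toLex (Sum.inl i)), b.filter fun j => p (toLex (Sum.inr j))) := by
  ext y
  obtain ⟨x, rfl⟩ := (toLex : ι₁ ⊕ ι₂ ≃ ι₁ ⊕ₗ ι₂).surjective y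
  rw [Finset.mem_filter, toLex_mem_iff, toLex_mem_iff]
  rcases x with i | j <;> simp

end Split

section Order

variable {ι₁ ι₂ : Type*} [LinearOrder ι₁] [LinearOrder ι₂]

/-- The orbitals of `a ⊔ b` below a left orbital `inl i` are the orbitals of `a` below `i`.
[folklore] -/
theorem card_filter_lt_toLex_inl (i : ι₁) (a : Finset ι₁) (b : Finset ι₂) :
    ((splitEquiv.symm (a, b) : Finset (ι₁ ⊕ₗ ι₂)).filter (· < toLex (Sum.inl i))).card =
      (a.filter (· < i)).card := by
  rw [filter_splitEquiv_symm, card_splitEquiv_symm]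
  have h1 : (a.filter fun i' => (toLex (Sum.inl i') : ι₁ ⊕ₗ ι₂) < toLex (Sum.inl i)) =
      a.filter (· < i) := by
    refine Finset.filter_congr fun i' _ => ?_
    exact Sum.Lex.inl_lt_inl_iff
  have h2 : (b.filter fun j => (toLex (Sum.inr j) : ι₁ ⊕ₗ ι₂) < toLex (Sum.inl i)) = ∅ := by
    refine Finset.filter_false_of_mem fun j _ => ?_
    exact Sum.Lex.not_inr_lt_inl
  rw [h1, h2, Finset.card_empty, add_zero]

/-- The orbitals of `a ⊔ b` below a right orbital `inr j` are all of `a` and the orbitals of `b`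
below `j`. [folklore] -/
theorem card_filter_lt_toLex_inr (j : ι₂) (a : Finset ι₁) (b : Finset ι₂) :
    ((splitEquiv.symm (a, b) : Finset (ι₁ ⊕ₗ ι₂)).filter (· < toLex (Sum.inr j))).card =
      a.card + (b.filter (· < j)).card := by
  rw [filter_splitEquiv_symm, card_splitEquiv_symm]
  have h1 : (a.filter fun i => (toLex (Sum.inl i) : ι₁ ⊕ₗ ι₂) < toLex (Sum.inr j)) = a := by
    refine Finset.filter_true_of_mem fun i _ => ?_
    exact Sum.Lex.inl_lt_inr i j
  have h2 : (b.filter fun j' => (toLex (Sum.inr j') : ι₁ ⊕ₗ ι₂) < toLex (Sum.inr j)) =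
      b.filter (· < j) := by
    refine Finset.filter_congr fun j' _ => ?_
    exact Sum.Lex.inr_lt_inr_iff
  rw [h1, h2]

/-- **Jordan–Wigner sign of a left orbital**: no right orbital lies below it,
`σ_{inl i}(a ⊔ b) = σ_i(a)`. [cite: Lieb1994, p. 3 (left operators need not move through right ones)] -/
theorem jwSign_toLex_inl (i : ι₁) (a : Finset ι₁) (b : Finset ι₂) :
    jwSign (toLex (Sum.inl i) : ι₁ ⊕ₗ ι₂) (splitEquiv.symm (a, b)) = jwSign i a := by
  rw [jwSign, jwSign, card_filter_lt_toLex_inl]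

/-- **Jordan–Wigner sign of a right orbital**: all left orbitals lie below it,
`σ_{inr j}(a ⊔ b) = (-1)^{#a} σ_j(b)` — Lieb's "each such move gives rise to a `-1` factor".
[cite: Lieb1994, p. 3] -/
theorem jwSign_toLex_inr (j : ι₂) (a : Finset ι₁) (b : Finset ι₂) :
    jwSign (toLex (Sum.inr j) : ι₁ ⊕ₗ ι₂) (splitEquiv.symm (a, b)) = (-1) ^ a.card * jwSign j b := by
  rw [jwSign, jwSign, card_filter_lt_toLex_inr, pow_add]

/-! ### The Jordan–Wigner matrices as Kronecker products -/

/-- **`c_{inl i} = c_i ⊗ 1`** along the splitting of configurations.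
[cite: Lieb1994, proof of the Lemma (left/right algebras)] -/
theorem reindex_annihilation_inl (i : ι₁) :
    reindex splitEquiv splitEquiv (annihilation (toLex (Sum.inl i) : ι₁ ⊕ₗ ι₂)) =
      annihilation i ⊗ₖ (1 : Matrix (Finset ι₂) (Finset ι₂) ℂ) := by
  ext ⟨a, b⟩ ⟨a', b'⟩
  simp only [reindex_apply, submatrix_apply, kroneckerMap_apply, annihilation_apply, one_apply,
    toLex_inl_mem_iff, insert_toLex_inl, Equiv.apply_eq_iff_eq, Prod.mk.injEq, jwSign_toLex_inl]
  rcases eq_or_ne b b' with rfl | hb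
  · by_cases h1 : i ∈ a <;> by_cases h2 : a' = insert i a <;> simp [h1, h2]
  · simp [hb, hb.symm]

/-- **`c_{inr j} = (-1)^{N₁} ⊗ c_j`** along the splitting of configurations: a right annihilation
operator carries the parity of the left half (the Jordan–Wigner string through all left
orbitals). [cite: Lieb1994, proof of the Lemma, p. 3] -/
theorem reindex_annihilation_inr (j : ι₂) :
    reindex splitEquiv splitEquiv (annihilation (toLex (Sum.inr j) : ι₁ ⊕ₗ ι₂)) =
      (parityOp : Matrix (Finset ι₁) (Finset ι₁) ℂ) ⊗ₖ annihilation j := by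
  ext ⟨a, b⟩ ⟨a', b'⟩
  simp only [reindex_apply, submatrix_apply, kroneckerMap_apply, annihilation_apply, parityOp,
    diagonal_apply, toLex_inr_mem_iff, insert_toLex_inr, Equiv.apply_eq_iff_eq, Prod.mk.injEq,
    jwSign_toLex_inr]
  rcases eq_or_ne a a' with rfl | ha
  · by_cases h1 : j ∈ b <;> by_cases h2 : b' = insert j b <;> simp [h1, h2]
  · simp [ha, ha.symm]

/-- The parity operator is Hermitian (a real diagonal matrix). [folklore] -/
theorem parityOp_conjTranspose {ι : Type*} [LinearOrder ι] :
    (parityOp : Matrix (Finset ι) (Finset ι) ℂ)ᴴ = parityOp := by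
  rw [parityOp, diagonal_conjTranspose]
  congr 1
  funext s
  simp

/-- The parity operator is an involution, `P² = 1`. [folklore] -/
theorem parityOp_mul_parityOp {ι : Type*} [LinearOrder ι] [Fintype ι] :
    (parityOp : Matrix (Finset ι) (Finset ι) ℂ) * parityOp = 1 := by
  rw [parityOp, diagonal_mul_diagonal, ← diagonal_one]
  congr 1
  funext s
  rw [← pow_add, ← two_mul, pow_mul]
  norm_num

/-- **`c†_{inl i} = c†_i ⊗ 1`.** [cite: Lieb1994, proof of the Lemma] -/
theorem reindex_creation_inl (i : ι₁) :
    reindex splitEquiv splitEquiv (creation (toLex (Sum.inl i) : ι₁ ⊕ₗ ι₂)) =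
      creation i ⊗ₖ (1 : Matrix (Finset ι₂) (Finset ι₂) ℂ) := by
  rw [creation, ← conjTranspose_reindex, reindex_annihilation_inl, conjTranspose_kronecker,
    conjTranspose_one, creation]

/-- **`c†_{inr j} = (-1)^{N₁} ⊗ c†_j`.** [cite: Lieb1994, proof of the Lemma] -/
theorem reindex_creation_inr (j : ι₂) :
    reindex splitEquiv splitEquiv (creation (toLex (Sum.inr j) : ι₁ ⊕ₗ ι₂)) =
      (parityOp : Matrix (Finset ι₁) (Finset ι₁) ℂ) ⊗ₖ creation j := by
  rw [creation, ← conjTranspose_reindex, reindex_annihilation_inr, conjTranspose_kronecker,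
    parityOp_conjTranspose, creation]

variable [Fintype ι₁] [Fintype ι₂]

/-- The splitting as an algebra equivalence of the Fock-space matrix algebras (Mathlib's
`Matrix.reindexAlgEquiv`). [folklore] -/
abbrev splitAlgEquiv : Matrix (Finset (ι₁ ⊕ₗ ι₂)) (Finset (ι₁ ⊕ₗ ι₂)) ℂ ≃ₐ[ℂ]
    Matrix (Finset ι₁ × Finset ι₂) (Finset ι₁ × Finset ι₂) ℂ :=
  Matrix.reindexAlgEquiv ℂ ℂ splitEquiv

/-- `splitAlgEquiv` is `reindex splitEquiv splitEquiv`. [folklore] -/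
theorem splitAlgEquiv_apply (M : Matrix (Finset (ι₁ ⊕ₗ ι₂)) (Finset (ι₁ ⊕ₗ ι₂)) ℂ) :
    splitAlgEquiv M = reindex splitEquiv splitEquiv M := rfl

/-- **Left bilinears**: `c†_{inl i} c_{inl i'} = (c†_i c_{i'}) ⊗ 1`. [cite: Lieb1994, eq. (5) (`H_L`)] -/
theorem split_creation_inl_mul_annihilation_inl (i i' : ι₁) :
    splitAlgEquiv (creation (toLex (Sum.inl i) : ι₁ ⊕ₗ ι₂) * annihilation (toLex (Sum.inl i'))) =
      (creation i * annihilation i') ⊗ₖ (1 : Matrix (Finset ι₂) (Finset ι₂) ℂ) := by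
  rw [map_mul, splitAlgEquiv_apply, splitAlgEquiv_apply, reindex_creation_inl,
    reindex_annihilation_inl, ← mul_kronecker_mul, Matrix.mul_one]

/-- **Right bilinears**: `c†_{inr j} c_{inr j'} = 1 ⊗ (c†_j c_{j'})` (the two parity strings
cancel: even right operators commute with everything on the left). [cite: Lieb1994, eq. (5) (`H_R`) and p. 3] -/
theorem split_creation_inr_mul_annihilation_inr (j j' : ι₂) :
    splitAlgEquiv (creation (toLex (Sum.inr j) : ι₁ ⊕ₗ ι₂) * annihilation (toLex (Sum.inr j'))) =
      (1 : Matrix (Finset ι₁) (Finset ι₁) ℂ) ⊗ₖ (creation j * annihilation j') := by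
  rw [map_mul, splitAlgEquiv_apply, splitAlgEquiv_apply, reindex_creation_inr,
    reindex_annihilation_inr, ← mul_kronecker_mul, parityOp_mul_parityOp]

/-- **Cross hopping, left to right**: `c†_{inl i} c_{inr j} = (c†_i P) ⊗ c_j` with `P = (-1)^{N₁}`
— Lieb's cross term `c†_l c_r` written as `A_L ⊗ B_R` [Lieb1994, proof of the Lemma, case (ii)].
[cite: Lieb1994, proof of the Lemma, p. 3] -/
theorem split_creation_inl_mul_annihilation_inr (i : ι₁) (j : ι₂) :
    splitAlgEquiv (creation (toLex (Sum.inl i) : ι₁ ⊕ₗ ι₂) * annihilation (toLex (Sum.inr j))) =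
      (creation i * parityOp) ⊗ₖ annihilation j := by
  rw [map_mul, splitAlgEquiv_apply, splitAlgEquiv_apply, reindex_creation_inl,
    reindex_annihilation_inr, ← mul_kronecker_mul, Matrix.one_mul]

/-- **Cross hopping, right to left**: `c†_{inr j} c_{inl i} = (P c_i) ⊗ c†_j`
[Lieb1994, proof of the Lemma, case (iii): `-c_l c†_r`; here `P c_i = -c_i P`].
[cite: Lieb1994, proof of the Lemma, p. 3] -/
theorem split_creation_inr_mul_annihilation_inl (i : ι₁) (j : ι₂) :
    splitAlgEquiv (creation (toLex (Sum.inr j) : ι₁ ⊕ₗ ι₂) * annihilation (toLex (Sum.inl i))) =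
      (parityOp * annihilation i) ⊗ₖ creation j := by
  rw [map_mul, splitAlgEquiv_apply, splitAlgEquiv_apply, reindex_creation_inr,
    reindex_annihilation_inl, ← mul_kronecker_mul, Matrix.mul_one]

/-- Left number operators: `n_{inl i} = n_i ⊗ 1`. [folklore] -/
theorem split_numberAt_inl (i : ι₁) :
    splitAlgEquiv (numberAt (toLex (Sum.inl i) : ι₁ ⊕ₗ ι₂)) =
      numberAt i ⊗ₖ (1 : Matrix (Finset ι₂) (Finset ι₂) ℂ) :=
  split_creation_inl_mul_annihilation_inl i i

/-- Right number operators: `n_{inr j} = 1 ⊗ n_j`. [folklore] -/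
theorem split_numberAt_inr (j : ι₂) :
    splitAlgEquiv (numberAt (toLex (Sum.inr j) : ι₁ ⊕ₗ ι₂)) =
      (1 : Matrix (Finset ι₁) (Finset ι₁) ℂ) ⊗ₖ numberAt j :=
  split_creation_inr_mul_annihilation_inr j j

/-- The identity splits as `1 ⊗ 1`. [folklore] -/
theorem split_one :
    splitAlgEquiv (1 : Matrix (Finset (ι₁ ⊕ₗ ι₂)) (Finset (ι₁ ⊕ₗ ι₂)) ℂ) =
      (1 : Matrix (Finset ι₁) (Finset ι₁) ℂ) ⊗ₖ (1 : Matrix (Finset ι₂) (Finset ι₂) ℂ) := by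
  rw [map_one, one_kronecker_one]

end Order

end JWSplit

end Literature.MathematicalPhysics.QuantumLattice

end
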